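import Literature.Analysis.FluidPDE.PlanarMoveAssembly
import HarnessLib

/-!
# Local cases from space-time regions: cores, junctions and tubes

Topic `Literature/Analysis/FluidPDE`. Seventh file of the explicit pullback calculus for the
planar transport equation. `PlanarMoveAssembly.lean` reduces the transport of the assembled
fields `Θ = Σ χ_k Θ_k`, `V = ∇⊥(H₀ + Σ χ_k (H_k - H₀))` at a space-time point to ONE of three
local cases (`AssemblyCase`: core, junction, far). This file derives the local case at EVERY
point of a region `S × Q` from set-theoretic data — the form in which an explicit design is
checked:

* for each element `k`, an OPEN space-time **core** `Core k ⊆ ℝ × ℝ²` on which `χ_k = 1` and all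
  other cut-offs vanish, and an OPEN **junction** `Junc k` on which `χ_k + χ_{k+1} = 1`, the other
  cut-offs vanish and the elements `k`, `k+1` agree (`Θ_{k+1} = Θ_k`, `H_{k+1} = H_k`);
* for each element `j`, a CLOSED space-time **tube** `Tube j` outside which `χ_j Θ_j` vanishes;
* the **cover** condition: every point of `S × Q` lying in some tube lies in some core or some
  junction;
* transport of each element by its own stream function on its core and junction.

Then `AssemblyCase` holds at every point of `S × Q` (`assemblyCase_of_regions`), hence transport
(`transport_assembled_of_regions`); the same data bound `|Θ|` (`abs_assembledScalar_le_of_regions`),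
and closed **stream tubes** outside which `χ_j (H_j - H₀)` vanishes make the assembled velocity
vanish off them (`assembledVelocity_eq_zero_off_streamTubes`) — tangency and the boundary strips.
Moving elements are allowed: all regions are space-time sets (typically a time interval times a
box, or a band following a moving line), openness / closedness being their only topology used.

Folklore; no named facts. Infrastructure towards a discharge of `acm_compatible_blocks`
(`QuasiSelfSimilarCompatibleBlocks.lean`).

## References

* G. Alberti, G. Crippa, A. L. Mazzucato, *Exponential self-similar mixing by incompressible
  flows*, J. Amer. Math. Soc. 32 (2019), 445–490, §§7–8 (arXiv:1605.02090).
-/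

noncomputable section

open Function Set Filter
open scoped Topology ContDiff

namespace Literature.Analysis.FluidPDE

namespace PlanarKinematics

/-- The plane `ℝ²` as a Euclidean space. [folklore] -/
local notation "E²" => EuclideanSpace ℝ (Fin 2)

section Regions

variable {K : ℕ} {H₀ : ℝ} {χ Θ H : ℕ → ℝ → E² → ℝ}
  {Core Junc Tube : ℕ → Set (ℝ × E²)} {S : Set ℝ} {Q : Set E²}

/-- **Region data of an assembly**: open cores and junctions with their cut-off identities,
closed tubes carrying the products `χ_j Θ_j`, and the cover of the tubes over `S × Q` by cores
and junctions. [folklore] -/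
structure IsRegionData (K : ℕ) (χ Θ H : ℕ → ℝ → E² → ℝ) (Core Junc Tube : ℕ → Set (ℝ × E²))
    (S : Set ℝ) (Q : Set E²) : Prop where
  /-- cores are open in space-time -/
  isOpen_core : ∀ k < K, IsOpen (Core k)
  /-- junctions are open in space-time -/
  isOpen_junc : ∀ k, k + 1 < K → IsOpen (Junc k)
  /-- tubes are closed in space-time -/
  isClosed_tube : ∀ j < K, IsClosed (Tube j)
  /-- on the core of `k`: `χ_k = 1` -/
  core_one : ∀ k < K, ∀ p ∈ Core k, χ k p.1 p.2 = 1
  /-- on the core of `k`: the other cut-offs vanish -/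
  core_zero : ∀ k < K, ∀ p ∈ Core k, ∀ j < K, j ≠ k → χ j p.1 p.2 = 0
  /-- on the junction of `k, k+1`: `χ_k + χ_{k+1} = 1` -/
  junc_sum : ∀ k, k + 1 < K → ∀ p ∈ Junc k, χ k p.1 p.2 + χ (k + 1) p.1 p.2 = 1
  /-- on the junction of `k, k+1`: the other cut-offs vanish -/
  junc_zero : ∀ k, k + 1 < K → ∀ p ∈ Junc k, ∀ j < K, j ≠ k → j ≠ k + 1 → χ j p.1 p.2 = 0
  /-- on the junction of `k, k+1`: the two scalars agree -/
  junc_scalar : ∀ k, k + 1 < K → ∀ p ∈ Junc k, Θ (k + 1) p.1 p.2 = Θ k p.1 p.2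
  /-- on the junction of `k, k+1`: the two stream functions agree -/
  junc_stream : ∀ k, k + 1 < K → ∀ p ∈ Junc k, H (k + 1) p.1 p.2 = H k p.1 p.2
  /-- `χ_j Θ_j` lives in the tube of `j` -/
  tube : ∀ j < K, ∀ p, χ j p.1 p.2 * Θ j p.1 p.2 ≠ 0 → p ∈ Tube j
  /-- every point of `S × Q` in some tube is in some core or junction -/
  cover : ∀ t ∈ S, ∀ z ∈ Q, (∃ j < K, (t, z) ∈ Tube j) →
    (∃ k < K, (t, z) ∈ Core k) ∨ ∃ k, k + 1 < K ∧ (t, z) ∈ Junc k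

/-- Membership in an open space-time set gives an eventual statement at the point. [folklore] -/
theorem eventually_of_mem_open {U : Set (ℝ × E²)} {P : ℝ → E² → Prop} (hU : IsOpen U) {p : ℝ × E²}
    (hp : p ∈ U) (h : ∀ q ∈ U, P q.1 q.2) : ∀ᶠ q in 𝓝 p, P q.1 q.2 :=
  Filter.eventually_of_mem (hU.mem_nhds hp) h

/-- **Local cases from region data**: with region data on `S × Q` and each element transported by
its own stream function on its core and junction (for times in `S`), `AssemblyCase` holds at
every point of `S × Q`. [folklore] -/
theorem assemblyCase_of_regions (hR : IsRegionData K χ Θ H Core Junc Tube S Q)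
    (htr : ∀ k < K, ∀ t ∈ S, ∀ z : E², ((t, z) ∈ Core k ∨ (t, z) ∈ Junc k) →
      deriv (fun s => Θ k s z) t + fderiv ℝ (Θ k t) z (perpGrad (H k t) z) = 0) :
    ∀ t ∈ S, ∀ z ∈ Q, AssemblyCase K χ Θ H t z := by
  intro t ht z hz
  by_cases hc : ∃ k < K, (t, z) ∈ Core k
  · obtain ⟨k, hk, hp⟩ := hc
    exact AssemblyCase.core k hk
      (eventually_of_mem_open (P := fun s w => χ k s w = 1) (hR.isOpen_core k hk) hp (hR.core_one k hk))
      (fun j hj hjk => eventually_of_mem_open (P := fun s w => χ j s w = 0) (hR.isOpen_core k hk) hp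
        fun q hq => hR.core_zero k hk q hq j hj hjk)
      (htr k hk t ht z (Or.inl hp))
  by_cases hj : ∃ k, k + 1 < K ∧ (t, z) ∈ Junc k
  · obtain ⟨k, hk, hp⟩ := hj
    exact AssemblyCase.junction k hk
      (eventually_of_mem_open (P := fun s w => χ k s w + χ (k + 1) s w = 1) (hR.isOpen_junc k hk) hp
        (hR.junc_sum k hk))
      (fun j hj' hjk hjk1 => eventually_of_mem_open (P := fun s w => χ j s w = 0) (hR.isOpen_junc k hk) hp
        fun q hq => hR.junc_zero k hk q hq j hj' hjk hjk1)
      (eventually_of_mem_open (P := fun s w => Θ (k + 1) s w = Θ k s w) (hR.isOpen_junc k hk) hp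
        (hR.junc_scalar k hk))
      (eventually_of_mem_open (P := fun s w => H (k + 1) s w = H k s w) (hR.isOpen_junc k hk) hp
        (hR.junc_stream k hk))
      (htr k (by omega) t ht z (Or.inr hp))
  -- far: the point lies in no tube, hence has a neighbourhood missing each (closed) tube
  have hfar : ∀ j < K, (t, z) ∉ Tube j := by
    intro j hj' hmem
    rcases hR.cover t ht z hz ⟨j, hj', hmem⟩ with h | h
    · exact hc h
    · exact hj h
  refine AssemblyCase.far fun j hj' => ?_
  have hU : IsOpen (Tube j)ᶜ := (hR.isClosed_tube j hj').isOpen_compl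
  refine eventually_of_mem_open (P := fun s w => χ j s w * Θ j s w = 0) hU (hfar j hj') fun q hq => ?_
  by_contra hne
  exact hq (hR.tube j hj' q hne)

/-- **Transport of the assembled fields on `S × Q` from region data.** [folklore] -/
theorem transport_assembled_of_regions (hR : IsRegionData K χ Θ H Core Junc Tube S Q)
    (htr : ∀ k < K, ∀ t ∈ S, ∀ z : E², ((t, z) ∈ Core k ∨ (t, z) ∈ Junc k) →
      deriv (fun s => Θ k s z) t + fderiv ℝ (Θ k t) z (perpGrad (H k t) z) = 0) :
    ∀ t ∈ S, ∀ z ∈ Q, deriv (fun s => assembledScalar K χ Θ s z) t +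
      fderiv ℝ (assembledScalar K χ Θ t) z (assembledVelocity K H₀ χ H t z) = 0 :=
  transport_assembled_on (assemblyCase_of_regions hR htr)

/-- **Bound of the assembled scalar on `S × Q` from region data**: if `|Θ_k| ≤ M` (`M ≥ 0`) on
the core and junction of every element `k` for times in `S`, then `|Θ| ≤ M` on `S × Q`.
[folklore] -/
theorem abs_assembledScalar_le_of_regions {M : ℝ} (hR : IsRegionData K χ Θ H Core Junc Tube S Q)
    (hM : 0 ≤ M)
    (hb : ∀ k < K, ∀ t ∈ S, ∀ z : E², ((t, z) ∈ Core k ∨ (t, z) ∈ Junc k) → |Θ k t z| ≤ M) :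
    ∀ t ∈ S, ∀ z ∈ Q, |assembledScalar K χ Θ t z| ≤ M := by
  intro t ht z hz
  by_cases hc : ∃ k < K, (t, z) ∈ Core k
  · obtain ⟨k, hk, hp⟩ := hc
    exact abs_assembledScalar_le_of_core hk (hR.core_one k hk _ hp)
      (fun j hj hjk => hR.core_zero k hk _ hp j hj hjk) (hb k hk t ht z (Or.inl hp))
  by_cases hj : ∃ k, k + 1 < K ∧ (t, z) ∈ Junc k
  · obtain ⟨k, hk, hp⟩ := hj
    exact abs_assembledScalar_le_of_junction hk (hR.junc_sum k hk _ hp)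
      (fun j hj' hjk hjk1 => hR.junc_zero k hk _ hp j hj' hjk hjk1) (hR.junc_scalar k hk _ hp)
      (hb k (by omega) t ht z (Or.inr hp))
  refine abs_assembledScalar_le_of_far hM fun j hj' => ?_
  by_contra hne
  rcases hR.cover t ht z hz ⟨j, hj', hR.tube j hj' _ hne⟩ with h | h
  · exact hc h
  · exact hj h

/-- **The assembled scalar at a point outside all tubes vanishes.** [folklore] -/
theorem assembledScalar_eq_zero_off_tubes (htube : ∀ j < K, ∀ p : ℝ × E², χ j p.1 p.2 * Θ j p.1 p.2 ≠ 0 → p ∈ Tube j)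
    {t : ℝ} {z : E²} (hz : ∀ j < K, (t, z) ∉ Tube j) : assembledScalar K χ Θ t z = 0 := by
  rw [assembledScalar_apply]
  refine Finset.sum_eq_zero fun j hj => ?_
  by_contra hne
  exact hz j (Finset.mem_range.1 hj) (htube j (Finset.mem_range.1 hj) _ hne)

/-- **The assembled velocity vanishes off the stream tubes**: if closed space-time sets
`TubeH j` carry the products `χ_j (H_j - H₀)`, then at every point outside all of them the
assembled velocity vanishes (the stream function is locally the background constant). Applied to
the boundary strips of the square away from the gate windows. [folklore] -/
theorem assembledVelocity_eq_zero_off_streamTubes {TubeH : ℕ → Set (ℝ × E²)}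
    (hcl : ∀ j < K, IsClosed (TubeH j))
    (htube : ∀ j < K, ∀ p : ℝ × E², χ j p.1 p.2 * (H j p.1 p.2 - H₀) ≠ 0 → p ∈ TubeH j)
    {t : ℝ} {z : E²} (hz : ∀ j < K, (t, z) ∉ TubeH j) : assembledVelocity K H₀ χ H t z = 0 := by
  refine assembledVelocity_eq_zero_of_far fun j hj => ?_
  have hU : IsOpen (TubeH j)ᶜ := (hcl j hj).isOpen_compl
  have hev : ∀ᶠ q in 𝓝 (t, z), χ j q.1 q.2 * (H j q.1 q.2 - H₀) = 0 :=
    eventually_of_mem_open (P := fun s w => χ j s w * (H j s w - H₀) = 0) hU (hz j hj) fun q hq => by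
      by_contra hne
      exact hq (htube j hj q hne)
  exact eventually_slice (P := fun s w => χ j s w * (H j s w - H₀) = 0) hev

/-- **The assembled scalar vanishes off the tubes, as a space-time eventual statement** (closed
tubes): used for the boundary-strip clause `Θ = 0`. [folklore] -/
theorem assembledScalar_eventually_zero_off_tubes (hcl : ∀ j < K, IsClosed (Tube j))
    (htube : ∀ j < K, ∀ p : ℝ × E², χ j p.1 p.2 * Θ j p.1 p.2 ≠ 0 → p ∈ Tube j)
    {t : ℝ} {z : E²} (hz : ∀ j < K, (t, z) ∉ Tube j) :
    ∀ᶠ q in 𝓝 (t, z), assembledScalar K χ Θ q.1 q.2 = 0 := by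
  refine assembledScalar_eq_zero_of_far fun j hj => ?_
  have hU : IsOpen (Tube j)ᶜ := (hcl j hj).isOpen_compl
  exact eventually_of_mem_open (P := fun s w => χ j s w * Θ j s w = 0) hU (hz j hj) fun q hq => by
    by_contra hne
    exact hq (htube j hj q hne)

/-! ## Building region data: common shapes of space-time regions -/

/-- A time-independent open planar set gives an open space-time region. [folklore] -/
theorem isOpen_univ_prod {U : Set E²} (hU : IsOpen U) : IsOpen {p : ℝ × E² | p.2 ∈ U} :=
  hU.preimage continuous_snd

/-- A time-independent closed planar set gives a closed space-time region. [folklore] -/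
theorem isClosed_univ_prod {C : Set E²} (hC : IsClosed C) : IsClosed {p : ℝ × E² | p.2 ∈ C} :=
  hC.preimage continuous_snd

/-- **Open box**: `{z | a₀ < z₀ < b₀, a₁ < z₁ < b₁}` is open. [folklore] -/
theorem isOpen_box (a₀ b₀ a₁ b₁ : ℝ) :
    IsOpen {z : E² | a₀ < z 0 ∧ z 0 < b₀ ∧ a₁ < z 1 ∧ z 1 < b₁} := by
  have hc : Continuous fun z : E² => (z 0, z 1) :=
    (EuclideanSpace.proj (0 : Fin 2)).continuous.prodMk (EuclideanSpace.proj (1 : Fin 2)).continuous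
  have h := ((isOpen_Ioo (a := a₀) (b := b₀)).prod (isOpen_Ioo (a := a₁) (b := b₁))).preimage hc
  convert h using 1
  ext z
  simp only [mem_setOf_eq, mem_preimage, mem_prod, mem_Ioo, and_assoc]

/-- **Closed box**: `{z | a₀ ≤ z₀ ≤ b₀, a₁ ≤ z₁ ≤ b₁}` is closed. [folklore] -/
theorem isClosed_box (a₀ b₀ a₁ b₁ : ℝ) :
    IsClosed {z : E² | a₀ ≤ z 0 ∧ z 0 ≤ b₀ ∧ a₁ ≤ z 1 ∧ z 1 ≤ b₁} := by
  have hc : Continuous fun z : E² => (z 0, z 1) :=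
    (EuclideanSpace.proj (0 : Fin 2)).continuous.prodMk (EuclideanSpace.proj (1 : Fin 2)).continuous
  have h := ((isClosed_Icc (a := a₀) (b := b₀)).prod (isClosed_Icc (a := a₁) (b := b₁))).preimage hc
  convert h using 1
  ext z
  simp only [mem_setOf_eq, mem_preimage, mem_prod, mem_Icc, and_assoc]

/-- **Moving open band**: for continuous `c : ℝ → ℝ` and a continuous coordinate functional
`ℓ`, the space-time set `{(t,z) | |ℓ z - c t| < r}` is open (a band following a moving line).
[folklore] -/
theorem isOpen_movingBand {c : ℝ → ℝ} (hc : Continuous c) {ℓ : E² → ℝ} (hℓ : Continuous ℓ) (r : ℝ) :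
    IsOpen {p : ℝ × E² | |ℓ p.2 - c p.1| < r} :=
  isOpen_lt ((hℓ.comp continuous_snd).sub (hc.comp continuous_fst)).abs continuous_const

/-- **Moving closed band**: `{(t,z) | |ℓ z - c t| ≤ r}` is closed. [folklore] -/
theorem isClosed_movingBand {c : ℝ → ℝ} (hc : Continuous c) {ℓ : E² → ℝ} (hℓ : Continuous ℓ) (r : ℝ) :
    IsClosed {p : ℝ × E² | |ℓ p.2 - c p.1| ≤ r} :=
  isClosed_le ((hℓ.comp continuous_snd).sub (hc.comp continuous_fst)).abs continuous_const

end Regions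

end PlanarKinematics

end Literature.Analysis.FluidPDE
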